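import Literature.NumberTheory.GaloisRepresentations.LubinTateColemanUnitsImageGaloisTopologyTwo
import Literature.NumberTheory.EllipticCurves.PAdicOneVariableRelNormCoherentUnitsRayAction
import HarnessLib

/-!
# The CLOSURE `𝒞̄` of the group generated by a family of principal coherent tower units `β_𝔠` and their inverses is a closed subgroup of
# `𝒰¹_∞`, stable under `Γ_F` as soon as the Galois translates of the generators lie in it — the hypotheses of `colemanImageSubmodule`
# (de Shalit III §1.4: "`C̄_n` the closure of `C_n` … `𝒞_𝔣 = lim← ⟨C̄_n⟩`") for the elliptic-unit family

De Shalit, *Iwasawa theory of elliptic curves with complex multiplication* (1987), III §1.4 (the module `𝒞_𝔣` is the closure of the group generated by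
the elliptic units `e(𝔞)`; Remark p. 91: "`𝒞_𝔣` may be described as the group generated by the `β(𝔞)`"), II §2.4 (ii) (`e(𝔞)^{σ_𝔠} = e(𝔞𝔠)e(𝔠)^{−N𝔞}`:
the group generated by the `e(𝔞)` is stable under the Artin symbols, its closure under all of `Gal`).  The tree's one-stop (c)-theorems
(`LubinTateColemanUnitsImageGaloisTopologyTwo.colemanImageSubmodule`, `Summit…ColemanCoinvariantCharOfClosure/Closure`) take a SET `C` of tower
families with six hypotheses (closed, `⊆ 𝒰¹_∞`, `∋ 1`, closed under products, inverses and `Γ_F`).  THIS file discharges them for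
**`C := closure (Submonoid.closure (range β ∪ range β⁻¹))`** (0 sorry, no named facts, no definitions, no instances):

* §1 units at one level: `continuous_galAct_relNormCoherentUnits` (termwise `σ̃`, continuous: `continuous_toUnitBallHom`), `galAct_inv_relNormCoherentUnits`
  (`σ̃·β⁻¹ = (σ̃·β)⁻¹`), `inv_inv_…`, `inv_mul_…`, `one_inv_…`; `norm_mul_sub_one_lt_one` (ultrametric: products of principal units are principal) and
  `mul_mem_principalCoherentFamilies` / `one_mem_principalCoherentFamilies` (with the tree's `inv_mem_…`, `galAct_mem_…`: `𝒰¹_∞` is a `Γ_F`-group);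
* §2 closures in `∏_m 𝒰(E_m·K_π^∞)`: a subset `S₀ ⊆ 𝒰¹_∞` containing `1` and closed under products / inverses has a closure with the same properties
  (`mul_mem_closure_of_forall`, `inv_mem_closure_of_forall` — `map_mem_closure₂`, continuity of `mul`, `inv`), `closure_subset_principalCoherentFamilies`
  (`𝒰¹_∞` is closed), and ★ `galAct_mem_closure_of_forall` (if `σ̃·S₀ ⊆ closure S₀` then `σ̃·closure S₀ ⊆ closure S₀`);
* §3 ★★ the generated monoid `T₀ = ⟨β_c, β_c⁻¹⟩`: `inv_mem_unitsGen` (closed under inverses), `unitsGen_subset_principalCoherentFamilies`,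
  ★ `galAct_mem_closure_unitsGen_of_generators` (Galois translates of the GENERATORS in `closure T₀` ⟹ of all of `T₀`), and the six hypotheses for
  `C = closure T₀`: `one_mem_closure_unitsGen`, `mul_mem_closure_unitsGen`, `inv_mem_closure_unitsGen`, ★★ `galAct_mem_closure_unitsGen`,
  `closure_unitsGen_subset_principalCoherentFamilies`, `mem_closure_unitsGen` (`β_c ∈ C`).

## References
* E. de Shalit, *Iwasawa theory of elliptic curves with complex multiplication* (1987), Ch. I §2.3, §3.8 (16); Ch. II §2.4 (ii); Ch. III §1.4. [deShalit1987]
* N. Bourbaki, *General Topology*, Ch. I §2.1 Th. 1; Ch. III §2.1 (closure of a subgroup of a topological group). [BourbakiGT1]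
-/

noncomputable section

open Filter Topology

namespace Literature.NumberTheory.EllipticCurves

/-! ### §1. One level: continuity of the Galois action, inverse laws, products of principal units -/

section OneLevel

open ValuativeRel Field
open Literature.NumberTheory.GaloisRepresentations Literature.NumberTheory.GaloisRepresentations.IsNonarchimedeanLocalField
  Literature.NumberTheory.GaloisRepresentations.LubinTate

variable {F : Type} [Field F] [ValuativeRel F] [TopologicalSpace F] [IsNonarchimedeanLocalField F]

attribute [local instance] ltNormUniformSpace ltNormIsUniformAddGroup rk1 nF nE fintypeResidueField

variable {π : 𝒪[F]} (hπ : (valuation F).IsUniformizer (π : F))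
variable (E : IntermediateField F (AlgebraicClosure F)) [FiniteDimensional F E] [IsGalois F E]

/-- **`β ↦ σ̃·β` is continuous** (termwise the isometry `σ̃|_{E·K_π^{m+1}}` on the unit ball). [cite: deShalit1987, Ch. I §2.3 (iv)] -/
theorem continuous_galAct_relNormCoherentUnits (σ : absoluteGaloisGroup F) :
    Continuous fun β : RelNormCoherentUnits hπ E => β.galAct σ :=
  (RelNormCoherentUnits.continuous_iff hπ E).mpr fun m =>
    (continuous_toUnitBallHom (relRestrict hπ E m σ)).comp (RelNormCoherentUnits.continuous_val_apply hπ E m)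

/-- `σ̃·β⁻¹ = (σ̃·β)⁻¹`. [cite: deShalit1987, Ch. I §2.3 (i), (iv)] -/
theorem galAct_inv_relNormCoherentUnits (σ : absoluteGaloisGroup F) (β : RelNormCoherentUnits hπ E) :
    (β.inv hπ E).galAct σ = (β.galAct σ).inv hπ E :=
  RelNormCoherentUnits.ext fun m => Subtype.ext (by
    rw [RelNormCoherentUnits.coe_val_galAct, RelNormCoherentUnits.coe_val_inv, RelNormCoherentUnits.coe_val_inv,
      RelNormCoherentUnits.coe_val_galAct, map_inv₀])

omit [IsGalois F E] in
/-- `(β⁻¹)⁻¹ = β`. [cite: deShalit1987, Ch. I §2.3 (i)] -/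
theorem inv_inv_relNormCoherentUnits (β : RelNormCoherentUnits hπ E) : (β.inv hπ E).inv hπ E = β :=
  RelNormCoherentUnits.ext fun m => Subtype.ext (by
    rw [RelNormCoherentUnits.coe_val_inv, RelNormCoherentUnits.coe_val_inv, inv_inv])

omit [IsGalois F E] in
/-- `(ββ′)⁻¹ = β⁻¹β′⁻¹`. [cite: deShalit1987, Ch. I §2.3 (i)] -/
theorem inv_mul_relNormCoherentUnits (β β' : RelNormCoherentUnits hπ E) :
    (β.mul β').inv hπ E = (β.inv hπ E).mul (β'.inv hπ E) :=
  RelNormCoherentUnits.ext fun m => Subtype.ext (by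
    simp only [RelNormCoherentUnits.coe_val_inv, RelNormCoherentUnits.val_mul, MulMemClass.coe_mul]
    rw [mul_inv])

omit [IsGalois F E] in
/-- `1⁻¹ = 1`. [cite: deShalit1987, Ch. I §2.3 (i)] -/
theorem one_inv_relNormCoherentUnits :
    (RelNormCoherentUnits.one : RelNormCoherentUnits hπ E).inv hπ E = RelNormCoherentUnits.one :=
  RelNormCoherentUnits.ext fun m => Subtype.ext (by
    rw [RelNormCoherentUnits.coe_val_inv, RelNormCoherentUnits.val_one, OneMemClass.coe_one, inv_one])

/-- **Products of principal units are principal** (ultrametric: `xy − 1 = x(y − 1) + (x − 1)`). [cite: SerreLocalFields1979, Ch. II §1] -/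
theorem norm_mul_sub_one_lt_one {K : Type*} [NormedField K] [IsUltrametricDist K] {x y : K} (hx1 : ‖x‖ = 1) (hx : ‖x - 1‖ < 1)
    (hy : ‖y - 1‖ < 1) : ‖x * y - 1‖ < 1 := by
  have e : x * y - 1 = x * (y - 1) + (x - 1) := by ring
  rw [e]
  refine lt_of_le_of_lt (IsUltrametricDist.norm_add_le_max _ _) (max_lt ?_ hx)
  rw [norm_mul, hx1, one_mul]
  exact hy

end OneLevel

/-! ### §2. Tower families: `𝒰¹_∞` is a group stable under `Γ_F`; closures keep the algebraic closure properties -/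

section Tower

open ValuativeRel Field
open Literature.NumberTheory.GaloisRepresentations Literature.NumberTheory.GaloisRepresentations.IsNonarchimedeanLocalField
  Literature.NumberTheory.GaloisRepresentations.LubinTate

variable {F : Type} [Field F] [ValuativeRel F] [TopologicalSpace F] [IsNonarchimedeanLocalField F]

attribute [local instance] ltNormUniformSpace ltNormIsUniformAddGroup rk1 nF nE fintypeResidueField

variable {π : 𝒪[F]} (hπ : (valuation F).IsUniformizer (π : F))
variable (E : ℕ → IntermediateField F (AlgebraicClosure F)) [∀ m, FiniteDimensional F (E m)] [∀ m, Normal F (E m)]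
  [∀ m, IsGalois F (E m)] (hmono : Monotone E)

omit [∀ m, Normal F (E m)] in
/-- **Products of principal coherent families are principal coherent.** [cite: deShalit1987, Ch. I §3.8 (16)] -/
theorem mul_mem_principalCoherentFamilies {β β' : ∀ m, RelNormCoherentUnits hπ (E m)} (hβ : β ∈ principalCoherentFamilies hπ E hmono)
    (hβ' : β' ∈ principalCoherentFamilies hπ E hmono) :
    (fun m => (β m).mul (β' m)) ∈ principalCoherentFamilies hπ E hmono := by
  refine ⟨baseNormCoherent_mul hπ E hmono hβ.1 hβ'.1, fun m => ?_⟩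
  rw [RelNormCoherentUnits.val_mul, MulMemClass.coe_mul]
  exact norm_mul_sub_one_lt_one ((β m).norm_eq_one 0) (hβ.2 m) (hβ'.2 m)

omit [∀ m, Normal F (E m)] in
/-- The trivial family is principal coherent. [cite: deShalit1987, Ch. I §3.8 (16)] -/
theorem one_mem_principalCoherentFamilies :
    (fun m => (RelNormCoherentUnits.one : RelNormCoherentUnits hπ (E m))) ∈ principalCoherentFamilies hπ E hmono := by
  refine ⟨baseNormCoherent_one hπ E hmono, fun m => ?_⟩
  rw [RelNormCoherentUnits.val_one, OneMemClass.coe_one, sub_self, norm_zero]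
  exact one_pos

omit [∀ m, FiniteDimensional F (E m)] [∀ m, Normal F (E m)] [∀ m, IsGalois F (E m)] in
omit hmono in
/-- The closure of a product-closed set of families is product-closed (`(β, β′) ↦ ββ′` is continuous). [cite: BourbakiGT1, Ch. III §2.1] -/
theorem mul_mem_closure_of_forall [∀ m, FiniteDimensional F (E m)] {S₀ : Set (∀ m, RelNormCoherentUnits hπ (E m))}
    (hmul : ∀ s ∈ S₀, ∀ t ∈ S₀, (fun m => (s m).mul (t m)) ∈ S₀) {s t : ∀ m, RelNormCoherentUnits hπ (E m)}
    (hs : s ∈ closure S₀) (ht : t ∈ closure S₀) : (fun m => (s m).mul (t m)) ∈ closure S₀ := by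
  have hf : Continuous (Function.uncurry fun s t : (∀ m, RelNormCoherentUnits hπ (E m)) => fun m => (s m).mul (t m)) := by
    refine continuous_pi fun m => (RelNormCoherentUnits.continuous_iff hπ (E m)).mpr fun n => ?_
    change Continuous fun a : (∀ m, RelNormCoherentUnits hπ (E m)) × (∀ m, RelNormCoherentUnits hπ (E m)) => ((a.1 m).mul (a.2 m)).val n
    simp only [RelNormCoherentUnits.val_mul]
    exact ((RelNormCoherentUnits.continuous_val_apply hπ (E m) n).comp ((continuous_apply m).comp continuous_fst)).mul
      ((RelNormCoherentUnits.continuous_val_apply hπ (E m) n).comp ((continuous_apply m).comp continuous_snd))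
  exact map_mem_closure₂ hf hs ht hmul

omit [∀ m, FiniteDimensional F (E m)] [∀ m, Normal F (E m)] [∀ m, IsGalois F (E m)] in
omit hmono in
/-- The closure of an inverse-closed set of families is inverse-closed (`β ↦ β⁻¹` is continuous). [cite: BourbakiGT1, Ch. III §2.1] -/
theorem inv_mem_closure_of_forall [∀ m, FiniteDimensional F (E m)] {S₀ : Set (∀ m, RelNormCoherentUnits hπ (E m))}
    (hinv : ∀ s ∈ S₀, (fun m => (s m).inv hπ (E m)) ∈ S₀) {s : ∀ m, RelNormCoherentUnits hπ (E m)} (hs : s ∈ closure S₀) :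
    (fun m => (s m).inv hπ (E m)) ∈ closure S₀ :=
  map_mem_closure (f := fun s : ∀ m, RelNormCoherentUnits hπ (E m) => fun m => (s m).inv hπ (E m))
    (continuous_pi fun m => (RelNormCoherentUnits.continuous_inv hπ (E m)).comp (continuous_apply m)) hs hinv

omit hmono in
/-- ★ If the Galois translates of `S₀` lie in `closure S₀`, so do those of `closure S₀` (`β ↦ σ̃·β` is continuous). [cite: BourbakiGT1, Ch. I §2.1 Th. 1] -/
theorem galAct_mem_closure_of_forall {S₀ : Set (∀ m, RelNormCoherentUnits hπ (E m))} (σ : absoluteGaloisGroup F)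
    (hgal : ∀ s ∈ S₀, (fun m => (s m).galAct σ) ∈ closure S₀) {s : ∀ m, RelNormCoherentUnits hπ (E m)} (hs : s ∈ closure S₀) :
    (fun m => (s m).galAct σ) ∈ closure S₀ := by
  have h := map_mem_closure (f := fun s : ∀ m, RelNormCoherentUnits hπ (E m) => fun m => (s m).galAct σ) (t := closure S₀)
    (continuous_pi fun m => (continuous_galAct_relNormCoherentUnits hπ (E m) σ).comp (continuous_apply m)) hs hgal
  rwa [closure_closure] at h

omit [∀ m, Normal F (E m)] in
/-- The closure of a subset of `𝒰¹_∞` lies in `𝒰¹_∞` (which is closed). [cite: deShalit1987, Ch. III §1.3–1.4] -/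
theorem closure_subset_principalCoherentFamilies {S₀ : Set (∀ m, RelNormCoherentUnits hπ (E m))}
    (hsub : S₀ ⊆ principalCoherentFamilies hπ E hmono) : closure S₀ ⊆ principalCoherentFamilies hπ E hmono :=
  closure_minimal hsub (isClosed_principalCoherentFamilies hπ E hmono)

/-! ### §3. The monoid `T₀ = ⟨β_c, β_c⁻¹⟩` generated by a family and its closure `𝒞̄` -/

attribute [local instance] RelNormCoherentUnits.instCommMonoid

variable {I : Type*} (β : I → ∀ m, RelNormCoherentUnits hπ (E m))

omit [∀ m, Normal F (E m)] [∀ m, IsGalois F (E m)] in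
omit hmono in
/-- **`T₀` is closed under inverses** (its generating set is). [cite: deShalit1987, Ch. III §1.4] -/
theorem inv_mem_unitsGen {s : ∀ m, RelNormCoherentUnits hπ (E m)}
    (hs : s ∈ Submonoid.closure (Set.range β ∪ Set.range fun c => fun m => ((β c) m).inv hπ (E m))) :
    (fun m => (s m).inv hπ (E m)) ∈ Submonoid.closure (Set.range β ∪ Set.range fun c => fun m => ((β c) m).inv hπ (E m)) := by
  refine Submonoid.closure_induction (fun x hx => ?_) ?_ (fun x y _ _ hx hy => ?_) hs
  · rcases hx with ⟨c, rfl⟩ | ⟨c, rfl⟩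
    · exact Submonoid.subset_closure (Or.inr ⟨c, rfl⟩)
    · have e : (fun m => (((β c) m).inv hπ (E m)).inv hπ (E m)) = β c := funext fun m => inv_inv_relNormCoherentUnits hπ (E m) _
      rw [e]
      exact Submonoid.subset_closure (Or.inl ⟨c, rfl⟩)
  · have e : (fun m => ((1 : ∀ m, RelNormCoherentUnits hπ (E m)) m).inv hπ (E m)) = 1 :=
      funext fun m => one_inv_relNormCoherentUnits hπ (E m)
    rw [e]
    exact Submonoid.one_mem _
  · have e : (fun m => ((x * y) m).inv hπ (E m)) = (fun m => (x m).inv hπ (E m)) * fun m => (y m).inv hπ (E m) :=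
      funext fun m => inv_mul_relNormCoherentUnits hπ (E m) _ _
    rw [e]
    exact Submonoid.mul_mem _ hx hy

omit [∀ m, Normal F (E m)] in
/-- **`T₀ ⊆ 𝒰¹_∞`** when the generators are principal coherent. [cite: deShalit1987, Ch. III §1.4] -/
theorem unitsGen_subset_principalCoherentFamilies (hβ : ∀ c, β c ∈ principalCoherentFamilies hπ E hmono) :
    (Submonoid.closure (Set.range β ∪ Set.range fun c => fun m => ((β c) m).inv hπ (E m)) : Set (∀ m, RelNormCoherentUnits hπ (E m))) ⊆
      principalCoherentFamilies hπ E hmono := by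
  let P : Submonoid (∀ m, RelNormCoherentUnits hπ (E m)) :=
    { carrier := principalCoherentFamilies hπ E hmono
      mul_mem' := fun hs ht => mul_mem_principalCoherentFamilies hπ E hmono hs ht
      one_mem' := one_mem_principalCoherentFamilies hπ E hmono }
  have h : Submonoid.closure (Set.range β ∪ Set.range fun c => fun m => ((β c) m).inv hπ (E m)) ≤ P :=
    Submonoid.closure_le.mpr (by
      rintro s (⟨c, rfl⟩ | ⟨c, rfl⟩)
      · exact hβ c
      · exact inv_mem_principalCoherentFamilies hπ E hmono (hβ c))
  exact fun s hs => h hs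

omit hmono in
/-- ★ **Galois translates of the generators in `closure T₀` ⟹ Galois translates of all of `T₀` in `closure T₀`** (`σ̃` is multiplicative and commutes with
inversion; `closure T₀` is closed under products and inverses). [cite: deShalit1987, Ch. II §2.4 (ii); Ch. III §1.4] -/
theorem galAct_mem_closure_unitsGen_of_generators (σ : absoluteGaloisGroup F)
    (hgen : ∀ c, (fun m => ((β c) m).galAct σ) ∈
      closure (Submonoid.closure (Set.range β ∪ Set.range fun c => fun m => ((β c) m).inv hπ (E m)) : Set (∀ m, RelNormCoherentUnits hπ (E m))))
    {s : ∀ m, RelNormCoherentUnits hπ (E m)} (hs : s ∈ Submonoid.closure (Set.range β ∪ Set.range fun c => fun m => ((β c) m).inv hπ (E m))) :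
    (fun m => (s m).galAct σ) ∈
      closure (Submonoid.closure (Set.range β ∪ Set.range fun c => fun m => ((β c) m).inv hπ (E m)) : Set (∀ m, RelNormCoherentUnits hπ (E m))) := by
  set T : Submonoid (∀ m, RelNormCoherentUnits hπ (E m)) :=
    Submonoid.closure (Set.range β ∪ Set.range fun c => fun m => ((β c) m).inv hπ (E m)) with hT
  have hmulT : ∀ s ∈ (T : Set (∀ m, RelNormCoherentUnits hπ (E m))), ∀ t ∈ (T : Set (∀ m, RelNormCoherentUnits hπ (E m))),
      (fun m => (s m).mul (t m)) ∈ (T : Set (∀ m, RelNormCoherentUnits hπ (E m))) :=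
    fun s hs t ht => T.mul_mem hs ht
  have hinvT : ∀ s ∈ (T : Set (∀ m, RelNormCoherentUnits hπ (E m))),
      (fun m => (s m).inv hπ (E m)) ∈ (T : Set (∀ m, RelNormCoherentUnits hπ (E m))) :=
    fun s hs => inv_mem_unitsGen hπ E β hs
  refine Submonoid.closure_induction (fun x hx => ?_) ?_ (fun x y _ _ hx hy => ?_) hs
  · rcases hx with ⟨c, rfl⟩ | ⟨c, rfl⟩
    · exact hgen c
    · have e : (fun m => (((β c) m).inv hπ (E m)).galAct σ) = fun m => (((β c) m).galAct σ).inv hπ (E m) :=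
        funext fun m => galAct_inv_relNormCoherentUnits hπ (E m) σ _
      rw [e]
      exact inv_mem_closure_of_forall hπ E hinvT (hgen c)
  · have e : (fun m => ((1 : ∀ m, RelNormCoherentUnits hπ (E m)) m).galAct σ) = 1 :=
      funext fun m => RelNormCoherentUnits.galAct_one_right' σ
    rw [e]
    exact subset_closure (Submonoid.one_mem _)
  · have e : (fun m => ((x * y) m).galAct σ) = fun m => ((x m).galAct σ).mul ((y m).galAct σ) :=
      funext fun m => RelNormCoherentUnits.galAct_mul σ _ _
    rw [e]
    exact mul_mem_closure_of_forall hπ E hmulT hx hy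

/-! #### The six hypotheses of `colemanImageSubmodule` for `C := closure T₀` -/

omit [∀ m, Normal F (E m)] [∀ m, IsGalois F (E m)] in
omit hmono in
/-- `β_c ∈ closure T₀`. [cite: deShalit1987, Ch. III §1.4] -/
theorem mem_closure_unitsGen (c : I) :
    β c ∈ closure (Submonoid.closure (Set.range β ∪ Set.range fun c => fun m => ((β c) m).inv hπ (E m)) : Set (∀ m, RelNormCoherentUnits hπ (E m))) :=
  subset_closure (Submonoid.subset_closure (Or.inl ⟨c, rfl⟩))

omit [∀ m, Normal F (E m)] [∀ m, IsGalois F (E m)] in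
omit hmono in
/-- `1 ∈ closure T₀`. [cite: deShalit1987, Ch. III §1.4] -/
theorem one_mem_closure_unitsGen :
    (fun m => (RelNormCoherentUnits.one : RelNormCoherentUnits hπ (E m))) ∈
      closure (Submonoid.closure (Set.range β ∪ Set.range fun c => fun m => ((β c) m).inv hπ (E m)) : Set (∀ m, RelNormCoherentUnits hπ (E m))) :=
  subset_closure (Submonoid.one_mem _)

omit [∀ m, Normal F (E m)] [∀ m, IsGalois F (E m)] in
omit hmono in
/-- `closure T₀` is closed under products. [cite: BourbakiGT1, Ch. III §2.1] -/
theorem mul_mem_closure_unitsGen :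
    ∀ s ∈ closure (Submonoid.closure (Set.range β ∪ Set.range fun c => fun m => ((β c) m).inv hπ (E m)) : Set (∀ m, RelNormCoherentUnits hπ (E m))),
    ∀ t ∈ closure (Submonoid.closure (Set.range β ∪ Set.range fun c => fun m => ((β c) m).inv hπ (E m)) : Set (∀ m, RelNormCoherentUnits hπ (E m))),
      (fun m => (s m).mul (t m)) ∈
        closure (Submonoid.closure (Set.range β ∪ Set.range fun c => fun m => ((β c) m).inv hπ (E m)) : Set (∀ m, RelNormCoherentUnits hπ (E m))) :=
  fun _ hs _ ht => mul_mem_closure_of_forall hπ E (fun _ hs' _ ht' => Submonoid.mul_mem _ hs' ht') hs ht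

omit [∀ m, Normal F (E m)] [∀ m, IsGalois F (E m)] in
omit hmono in
/-- `closure T₀` is closed under inverses. [cite: BourbakiGT1, Ch. III §2.1] -/
theorem inv_mem_closure_unitsGen :
    ∀ s ∈ closure (Submonoid.closure (Set.range β ∪ Set.range fun c => fun m => ((β c) m).inv hπ (E m)) : Set (∀ m, RelNormCoherentUnits hπ (E m))),
      (fun m => (s m).inv hπ (E m)) ∈
        closure (Submonoid.closure (Set.range β ∪ Set.range fun c => fun m => ((β c) m).inv hπ (E m)) : Set (∀ m, RelNormCoherentUnits hπ (E m))) :=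
  fun _ hs => inv_mem_closure_of_forall hπ E (fun _ hs' => inv_mem_unitsGen hπ E β hs') hs

omit hmono in
/-- ★★ **`closure T₀` is `Γ_F`-stable** as soon as the Galois translates of the generators `β_c` lie in it (II §2.4 (ii) for the Artin symbols + density for
the elliptic units). [cite: deShalit1987, Ch. II §2.4 (ii); Ch. III §1.4] -/
theorem galAct_mem_closure_unitsGen
    (hgen : ∀ (σ : absoluteGaloisGroup F) (c : I), (fun m => ((β c) m).galAct σ) ∈
      closure (Submonoid.closure (Set.range β ∪ Set.range fun c => fun m => ((β c) m).inv hπ (E m)) : Set (∀ m, RelNormCoherentUnits hπ (E m)))) :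
    ∀ (σ : absoluteGaloisGroup F), ∀ s ∈ closure (Submonoid.closure (Set.range β ∪ Set.range fun c => fun m => ((β c) m).inv hπ (E m)) :
      Set (∀ m, RelNormCoherentUnits hπ (E m))), (fun m => (s m).galAct σ) ∈
        closure (Submonoid.closure (Set.range β ∪ Set.range fun c => fun m => ((β c) m).inv hπ (E m)) : Set (∀ m, RelNormCoherentUnits hπ (E m))) :=
  fun σ _ hs => galAct_mem_closure_of_forall hπ E σ (fun _ ht => galAct_mem_closure_unitsGen_of_generators hπ E β σ (hgen σ) ht) hs

omit [∀ m, Normal F (E m)] in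
/-- `closure T₀ ⊆ 𝒰¹_∞`. [cite: deShalit1987, Ch. III §1.3–1.4] -/
theorem closure_unitsGen_subset_principalCoherentFamilies (hβ : ∀ c, β c ∈ principalCoherentFamilies hπ E hmono) :
    closure (Submonoid.closure (Set.range β ∪ Set.range fun c => fun m => ((β c) m).inv hπ (E m)) : Set (∀ m, RelNormCoherentUnits hπ (E m))) ⊆
      principalCoherentFamilies hπ E hmono :=
  closure_subset_principalCoherentFamilies hπ E hmono (unitsGen_subset_principalCoherentFamilies hπ E hmono β hβ)

end Tower

end Literature.NumberTheory.EllipticCurves
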